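import Literature.NumberTheory.EllipticCurves.BSDSelmerSmithTwistClassDensityProofs
import Literature.NumberTheory.EllipticCurves.BSDSelmerSmithDensityProofs
import Literature.NumberTheory.QuadraticFields.ThreeTorsionMeanSquarefreeCount
import HarnessLib

/-!
# `twistDensity` of a residue class `c (mod L)`: one sign, both signs, any modulus

Proof companion of `BSDSelmer.lean` (`Literature.NumberTheory.EllipticCurves.twistDensity P δ`: the
squarefree `d ∈ ℤ` with `P d` have natural density `δ` among all squarefree `d`, both signs, ordered by
`|d|` — Smith's normalisation of a quadratic twist family, arXiv:2503.17619 §1), continuing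
`BSDSelmerSmithTwistClassDensityProofs.lean` (classes mod `4`; the engine
`twistDensity_of_abs_sub_le_sqrt`; the total count `abs_card_filter_squarefree_sub_le`). THEOREMS ONLY.

Squarefree integers in an arithmetic progression (Prachar 1958; Orr 1971, §II (5)–(6):
`Q(x; k, l) = (x/k) Π_{p ∤ k} (1 − p⁻²) + R(x; k, l)` for `(l, k) = 1`; with the local corrections
`e(c, pᵏ)` for a general class: Taniguchi–Thorne 2013, Lemma 21) are counted in the tree on integer
intervals with error `5√M` (`Literature.NumberTheory.QuadraticFields.abs_card_squarefree_modEq_sub_le'`,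
main term `(b − a) ρ(c, L)/L`, `ρ(c, L) = (6/π²) Π_{p ∣ L} (1 − 𝟙_{G_p ∣ c} G_p/p²)(1 − p⁻²)⁻¹`,
`G_p = gcd(L, p²)`). Dividing by the total `(12/π²) X + O(√X)` gives the DENSITIES, for every `L ≥ 1`
and every class `c`:

* ★ `twistDensity_neg_modEq'` — the squarefree `d < 0` with `d ≡ c (mod L)` have `twistDensity`
  `(1/(2L)) Π_{p ∣ L} (1 − 𝟙_{G_p ∣ c} G_p/p²)(1 − p⁻²)⁻¹`; `twistDensity_pos_modEq'` — the same for
  `d > 0`; `twistDensity_modEq'` — both signs, `(1/L) Π_{p ∣ L} (…)`.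
* `twistDensity_neg_modEq` / `twistDensity_pos_modEq` / `twistDensity_modEq` — the coprime case
  `gcd(c, L) = 1` (Orr's `f(k)/k`): `(1/(2L)) Π_{p ∣ L} (1 − p⁻²)⁻¹` per sign, `(1/L) Π_{p ∣ L} (1 − p⁻²)⁻¹`
  in all (each odd class mod `8` carries `1/6`, each class `1, 3 (mod 4)` carries `1/3`).
* `twistDensity_neg`, `twistDensity_pos` — each sign carries density `1/2`.

Use: Heegner boxes, root-number classes and local conditions in quadratic twist families are finite
unions of such classes (crux `HeegnerTwistCouplingInSupply` of `Summits/BirchSwinnertonDyer`, whose research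
stub is a `twistDensity`-non-nullity statement and whose Heegner box contains the class `1 (mod 8N)`,
`d < 0`; the Kriz–Li / Goldfeld cluster `Kriz2020/…`, where the class `|d| ≡ 5, 6, 7 (mod 8)` is given
density `1/2` through Modularity). `Decidable` instances: as in the implementation note of
`BSDSelmerSmithTwistClassDensityProofs.lean` — all public statements here are in the instance-free
`twistDensity` currency.

## References
* [Orr1971] R. C. Orr, *Remainder estimates for squarefree integers in arithmetic progression*,
  J. Number Theory 3 (1971) 474–497, §II displays (5)–(6).
* [TaniguchiThorne2013] T. Taniguchi, F. Thorne, Duke Math. J. 162 (2013), Lemma 21 (local densities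
  of squarefree integers in a residue class).
* [MontgomeryVaughan2007] H. L. Montgomery, R. C. Vaughan, *Multiplicative Number Theory I*, §2.1 Thm. 2.2.
* [arXiv250317619] A. Smith, arXiv:2503.17619 (2025), §1 (the normalisation).
-/

noncomputable section

open scoped Classical
open Finset Filter Topology
open Literature.NumberTheory.QuadraticFields

namespace Literature.NumberTheory.EllipticCurves

/-! ### The counting sets of one class, one sign, as interval counts -/

/-- The squarefree `d` with `|d| ≤ X`, `d < 0`, `d ≡ c (mod L)` are the squarefree members of the class in
`[-X, 0)`. [folklore] -/
private theorem filter_squarefree_neg_modEq_eq (X L : ℕ) (c : ℤ) :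
    ((Icc (-(X : ℤ)) X).filter fun d : ℤ ↦ Squarefree d ∧ (d < 0 ∧ d ≡ c [ZMOD (L : ℤ)])) =
      (Ico (-(X : ℤ)) 0).filter (fun x => x ≡ c [ZMOD (L : ℤ)] ∧ Squarefree x) := by
  ext d
  simp only [mem_filter, mem_Icc, mem_Ico]
  constructor
  · rintro ⟨⟨h1, -⟩, hsq, hd0, hc⟩
    exact ⟨⟨h1, hd0⟩, hc, hsq⟩
  · rintro ⟨⟨h1, hd0⟩, hc, hsq⟩
    exact ⟨⟨h1, by omega⟩, hsq, hd0, hc⟩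

/-- The squarefree `d` with `|d| ≤ X`, `0 < d`, `d ≡ c (mod L)` are the squarefree members of the class in
`[1, X+1)`. [folklore] -/
private theorem filter_squarefree_pos_modEq_eq (X L : ℕ) (c : ℤ) :
    ((Icc (-(X : ℤ)) X).filter fun d : ℤ ↦ Squarefree d ∧ (0 < d ∧ d ≡ c [ZMOD (L : ℤ)])) =
      (Ico (1 : ℤ) ((X : ℤ) + 1)).filter (fun x => x ≡ c [ZMOD (L : ℤ)] ∧ Squarefree x) := by
  ext d
  simp only [mem_filter, mem_Icc, mem_Ico]
  constructor
  · rintro ⟨⟨-, h2⟩, hsq, hd0, hc⟩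
    exact ⟨⟨by omega, by omega⟩, hc, hsq⟩
  · rintro ⟨⟨h1, h2⟩, hc, hsq⟩
    exact ⟨⟨by omega, by omega⟩, hsq, by omega, hc⟩

/-- `√(X + 1) ≤ (3/2) √X` for `X ≥ 1`. [folklore] -/
private theorem sqrt_succ_le_of_pos {X : ℕ} (hX : 0 < X) :
    Real.sqrt ((X + 1 : ℕ) : ℝ) ≤ 3 / 2 * Real.sqrt X := by
  rw [show (3 : ℝ) / 2 * Real.sqrt X = Real.sqrt (9 / 4 * X) by
    rw [Real.sqrt_mul (by norm_num), show (9 : ℝ) / 4 = (3 / 2) ^ 2 by norm_num,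
      Real.sqrt_sq (by norm_num)]]
  apply Real.sqrt_le_sqrt
  have : (1 : ℝ) ≤ X := by exact_mod_cast hX
  push_cast
  linarith

/-- **The class count, negative sign, with square-root error**: for `L ≥ 1` and any `c`,
`|#{d squarefree : |d| ≤ X, d < 0, d ≡ c (mod L)} − (X/L) ρ(c, L)| ≤ 5 √X`
(`abs_card_squarefree_modEq_sub_le'` on `[-X, 0)`). [cite: TaniguchiThorne2013, Lemma 21] -/
private theorem abs_card_filter_squarefree_neg_modEq_sub_le {L : ℕ} (hL : 0 < L) (c : ℤ) (X : ℕ) :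
    |((((Icc (-(X : ℤ)) X).filter fun d : ℤ ↦ Squarefree d ∧ (d < 0 ∧ d ≡ c [ZMOD (L : ℤ)])).card : ℕ) : ℝ)
        - (6 / Real.pi ^ 2 * (∏ p ∈ L.primeFactors,
          (1 - (if ((Nat.gcd L (p ^ 2) : ℕ) : ℤ) ∣ c then ((Nat.gcd L (p ^ 2) : ℕ) : ℝ) / (p : ℝ) ^ 2
            else 0)) * (1 - 1 / (p : ℝ) ^ 2)⁻¹) / L) * X| ≤ 5 * Real.sqrt X := by
  rw [filter_squarefree_neg_modEq_eq]
  have h := abs_card_squarefree_modEq_sub_le' hL c (a := -(X : ℤ)) (b := 0) (by omega) (Or.inl le_rfl)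
    (M := X) (by simp) (by simp)
  have hmain : ((0 : ℤ) : ℝ) - ((-(X : ℤ) : ℤ) : ℝ) = (X : ℝ) := by push_cast; ring
  rw [hmain] at h
  convert h using 3
  ring

/-- **The class count, positive sign, with square-root error**: for `L ≥ 1` and any `c`,
`|#{d squarefree : |d| ≤ X, 0 < d, d ≡ c (mod L)} − (X/L) ρ(c, L)| ≤ 8 √X`
(`abs_card_squarefree_modEq_sub_le'` on `[1, X+1)`, `5 √(X+1) ≤ 8 √X` for `X ≥ 1`).
[cite: TaniguchiThorne2013, Lemma 21] -/
private theorem abs_card_filter_squarefree_pos_modEq_sub_le {L : ℕ} (hL : 0 < L) (c : ℤ) (X : ℕ) :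
    |((((Icc (-(X : ℤ)) X).filter fun d : ℤ ↦ Squarefree d ∧ (0 < d ∧ d ≡ c [ZMOD (L : ℤ)])).card : ℕ) : ℝ)
        - (6 / Real.pi ^ 2 * (∏ p ∈ L.primeFactors,
          (1 - (if ((Nat.gcd L (p ^ 2) : ℕ) : ℤ) ∣ c then ((Nat.gcd L (p ^ 2) : ℕ) : ℝ) / (p : ℝ) ^ 2
            else 0)) * (1 - 1 / (p : ℝ) ^ 2)⁻¹) / L) * X| ≤ 8 * Real.sqrt X := by
  rw [filter_squarefree_pos_modEq_eq]
  rcases Nat.eq_zero_or_pos X with rfl | hX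
  · simp
  have h := abs_card_squarefree_modEq_sub_le' hL c (a := 1) (b := (X : ℤ) + 1) (by omega) (Or.inr one_pos)
    (M := X + 1) (by simp) (by omega)
  have hmain : (((X : ℤ) + 1 : ℤ) : ℝ) - ((1 : ℤ) : ℝ) = (X : ℝ) := by push_cast; ring
  rw [hmain] at h
  have h' : |((((Ico (1 : ℤ) ((X : ℤ) + 1)).filter
      (fun x => x ≡ c [ZMOD (L : ℤ)] ∧ Squarefree x)).card : ℕ) : ℝ) -
      (6 / Real.pi ^ 2 * (∏ p ∈ L.primeFactors,
          (1 - (if ((Nat.gcd L (p ^ 2) : ℕ) : ℤ) ∣ c then ((Nat.gcd L (p ^ 2) : ℕ) : ℝ) / (p : ℝ) ^ 2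
            else 0)) * (1 - 1 / (p : ℝ) ^ 2)⁻¹) / L) * X| ≤ 5 * Real.sqrt ((X + 1 : ℕ) : ℝ) := by
    convert h using 3
    ring
  have hsqrt := sqrt_succ_le_of_pos hX
  have hs0 := Real.sqrt_nonneg (X : ℝ)
  linarith

/-! ### The density of one residue class -/

/-- ★ **The `twistDensity` of a residue class, negative sign** (any modulus `L ≥ 1`, ANY class `c`): the
squarefree `d < 0` with `d ≡ c (mod L)` have natural density
`(1/(2L)) Π_{p ∣ L} (1 − 𝟙_{G_p ∣ c} G_p/p²)(1 − p⁻²)⁻¹`, `G_p = gcd(L, p²)`, among all squarefree integers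
(local factor `1 − 𝟙_{p ∣ c}/p` at `p ∥ L`, `1 − 𝟙_{p² ∣ c}` at `p² ∣ L`, Taniguchi–Thorne's `e(c, pᵏ)`;
`1` when `p ∤ c`) — the squarefree count in a residue class over the total count `(12/π²) X + O(√X)`.
[cite: TaniguchiThorne2013, Lemma 21] [cite: Orr1971, §II displays (5)–(6)] -/
theorem twistDensity_neg_modEq' {L : ℕ} (hL : 0 < L) (c : ℤ) :
    twistDensity (fun d => d < 0 ∧ d ≡ c [ZMOD (L : ℤ)])
      (1 / (2 * L) * ∏ p ∈ L.primeFactors,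
        (1 - (if ((Nat.gcd L (p ^ 2) : ℕ) : ℤ) ∣ c then ((Nat.gcd L (p ^ 2) : ℕ) : ℝ) / (p : ℝ) ^ 2
          else 0)) * (1 - 1 / (p : ℝ) ^ 2)⁻¹) := by
  set E : ℝ := ∏ p ∈ L.primeFactors,
    (1 - (if ((Nat.gcd L (p ^ 2) : ℕ) : ℤ) ∣ c then ((Nat.gcd L (p ^ 2) : ℕ) : ℝ) / (p : ℝ) ^ 2
      else 0)) * (1 - 1 / (p : ℝ) ^ 2)⁻¹ with hE
  have hL0 : (L : ℝ) ≠ 0 := by exact_mod_cast hL.ne'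
  have hkey : 1 / (2 * L) * E = (6 / Real.pi ^ 2 * E / L) / (12 / Real.pi ^ 2) := by
    field_simp
    ring
  rw [hkey]
  refine twistDensity_of_abs_sub_le_sqrt (C := 5) (C' := 18) (by positivity) (fun X => ?_)
    abs_card_filter_squarefree_sub_le
  convert abs_card_filter_squarefree_neg_modEq_sub_le hL c X

/-- ★ **The `twistDensity` of a residue class, positive sign**: the squarefree `d > 0` with
`d ≡ c (mod L)` have natural density `(1/(2L)) Π_{p ∣ L} (1 − 𝟙_{G_p ∣ c} G_p/p²)(1 − p⁻²)⁻¹`.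
[cite: TaniguchiThorne2013, Lemma 21] [cite: Orr1971, §II displays (5)–(6)] -/
theorem twistDensity_pos_modEq' {L : ℕ} (hL : 0 < L) (c : ℤ) :
    twistDensity (fun d => 0 < d ∧ d ≡ c [ZMOD (L : ℤ)])
      (1 / (2 * L) * ∏ p ∈ L.primeFactors,
        (1 - (if ((Nat.gcd L (p ^ 2) : ℕ) : ℤ) ∣ c then ((Nat.gcd L (p ^ 2) : ℕ) : ℝ) / (p : ℝ) ^ 2
          else 0)) * (1 - 1 / (p : ℝ) ^ 2)⁻¹) := by
  set E : ℝ := ∏ p ∈ L.primeFactors,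
    (1 - (if ((Nat.gcd L (p ^ 2) : ℕ) : ℤ) ∣ c then ((Nat.gcd L (p ^ 2) : ℕ) : ℝ) / (p : ℝ) ^ 2
      else 0)) * (1 - 1 / (p : ℝ) ^ 2)⁻¹ with hE
  have hL0 : (L : ℝ) ≠ 0 := by exact_mod_cast hL.ne'
  have hkey : 1 / (2 * L) * E = (6 / Real.pi ^ 2 * E / L) / (12 / Real.pi ^ 2) := by
    field_simp
    ring
  rw [hkey]
  refine twistDensity_of_abs_sub_le_sqrt (C := 8) (C' := 18) (by positivity) (fun X => ?_)
    abs_card_filter_squarefree_sub_le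
  convert abs_card_filter_squarefree_pos_modEq_sub_le hL c X

/-- ★ **The `twistDensity` of a residue class, both signs**: the squarefree `d` with `d ≡ c (mod L)` have
natural density `(1/L) Π_{p ∣ L} (1 − 𝟙_{G_p ∣ c} G_p/p²)(1 − p⁻²)⁻¹` (sum of the two signs; a squarefree `d`
is `≠ 0`). [cite: TaniguchiThorne2013, Lemma 21] [cite: Orr1971, §II displays (5)–(6)] -/
theorem twistDensity_modEq' {L : ℕ} (hL : 0 < L) (c : ℤ) :
    twistDensity (fun d => d ≡ c [ZMOD (L : ℤ)])
      (1 / L * ∏ p ∈ L.primeFactors,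
        (1 - (if ((Nat.gcd L (p ^ 2) : ℕ) : ℤ) ∣ c then ((Nat.gcd L (p ^ 2) : ℕ) : ℝ) / (p : ℝ) ^ 2
          else 0)) * (1 - 1 / (p : ℝ) ^ 2)⁻¹) := by
  have h := (twistDensity_neg_modEq' hL c).add (twistDensity_pos_modEq' hL c)
    (fun d _ h₁ h₂ => lt_asymm h₁.1 h₂.1)
  have hL0 : (L : ℝ) ≠ 0 := by exact_mod_cast hL.ne'
  rw [← add_mul, show (1 : ℝ) / (2 * L) + 1 / (2 * L) = 1 / L by field_simp; norm_num] at h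
  refine (twistDensity_congr (fun d hd => ?_) _).1 h
  have h0 : d ≠ 0 := fun h0 => by simp [h0] at hd
  constructor
  · rintro (⟨-, h⟩ | ⟨-, h⟩) <;> exact h
  · intro h
    rcases lt_or_gt_of_ne h0 with h' | h'
    · exact Or.inl ⟨h', h⟩
    · exact Or.inr ⟨h', h⟩

/-! ### Coprime classes: all local factors are `1` -/

/-- For `gcd(c, L) = 1` no local correction occurs: `G_p = gcd(L, p²)` does not divide `c` for `p ∣ L`,
so the density product is `Π_{p ∣ L} (1 − p⁻²)⁻¹`. [folklore] -/
private theorem prod_localFactor_eq_of_gcd_eq_one {L : ℕ} {c : ℤ} (hc : Int.gcd c L = 1) :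
    ∏ p ∈ L.primeFactors,
        (1 - (if ((Nat.gcd L (p ^ 2) : ℕ) : ℤ) ∣ c then ((Nat.gcd L (p ^ 2) : ℕ) : ℝ) / (p : ℝ) ^ 2
          else 0)) * (1 - 1 / (p : ℝ) ^ 2)⁻¹ =
      ∏ p ∈ L.primeFactors, (1 - 1 / (p : ℝ) ^ 2)⁻¹ := by
  refine Finset.prod_congr rfl fun p hp => ?_
  have hloc : ¬ ((Nat.gcd L (p ^ 2) : ℕ) : ℤ) ∣ c := by
    intro hdvd
    have hpP := Nat.prime_of_mem_primeFactors hp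
    have hpG : p ∣ Nat.gcd L (p ^ 2) :=
      Nat.dvd_gcd (Nat.dvd_of_mem_primeFactors hp) (dvd_pow_self p two_ne_zero)
    have hpc : (p : ℤ) ∣ c := (Int.natCast_dvd_natCast.2 hpG).trans hdvd
    have hp1 : p ∣ Int.gcd c L := by
      rw [Int.gcd_eq_natAbs, Int.natAbs_natCast]
      exact Nat.dvd_gcd (Int.natCast_dvd.1 hpc) (Nat.dvd_of_mem_primeFactors hp)
    rw [hc] at hp1
    exact hpP.one_lt.ne' (Nat.dvd_one.1 hp1)
  rw [if_neg hloc, sub_zero, one_mul]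

/-- **Coprime class, negative sign** (Orr's `f(k)/k`, halved for the sign): for `L ≥ 1`,
`gcd(c, L) = 1`, the squarefree `d < 0` with `d ≡ c (mod L)` have `twistDensity`
`(1/(2L)) Π_{p ∣ L} (1 − p⁻²)⁻¹` (e.g. `L = 8N`, `c = 1`: the progression inside every Heegner box of level
`N`). [cite: Orr1971, §II displays (5)–(6)] -/
theorem twistDensity_neg_modEq {L : ℕ} (hL : 0 < L) {c : ℤ} (hc : Int.gcd c L = 1) :
    twistDensity (fun d => d < 0 ∧ d ≡ c [ZMOD (L : ℤ)])
      (1 / (2 * L) * ∏ p ∈ L.primeFactors, (1 - 1 / (p : ℝ) ^ 2)⁻¹) := by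
  rw [← prod_localFactor_eq_of_gcd_eq_one hc]
  exact twistDensity_neg_modEq' hL c

/-- **Coprime class, positive sign**: for `L ≥ 1`, `gcd(c, L) = 1`, the squarefree `d > 0` with
`d ≡ c (mod L)` have `twistDensity` `(1/(2L)) Π_{p ∣ L} (1 − p⁻²)⁻¹`. [cite: Orr1971, §II displays (5)–(6)] -/
theorem twistDensity_pos_modEq {L : ℕ} (hL : 0 < L) {c : ℤ} (hc : Int.gcd c L = 1) :
    twistDensity (fun d => 0 < d ∧ d ≡ c [ZMOD (L : ℤ)])
      (1 / (2 * L) * ∏ p ∈ L.primeFactors, (1 - 1 / (p : ℝ) ^ 2)⁻¹) := by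
  rw [← prod_localFactor_eq_of_gcd_eq_one hc]
  exact twistDensity_pos_modEq' hL c

/-- **Coprime class, both signs** (Orr 1971: `Q(x; k, l) ∼ x f(k)/k`, `f(k) = Π_{p ∤ k}(1 − p⁻²)`, over
`Q(x) ∼ 6x/π²`): for `L ≥ 1`, `gcd(c, L) = 1`, the squarefree `d ≡ c (mod L)` have `twistDensity`
`(1/L) Π_{p ∣ L} (1 − p⁻²)⁻¹` (each odd class mod `8` carries `1/6` of the squarefree integers, each class
`1, 3 (mod 4)` carries `1/3`). [cite: Orr1971, §II displays (5)–(6)] -/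
theorem twistDensity_modEq {L : ℕ} (hL : 0 < L) {c : ℤ} (hc : Int.gcd c L = 1) :
    twistDensity (fun d => d ≡ c [ZMOD (L : ℤ)]) (1 / L * ∏ p ∈ L.primeFactors, (1 - 1 / (p : ℝ) ^ 2)⁻¹) := by
  rw [← prod_localFactor_eq_of_gcd_eq_one hc]
  exact twistDensity_modEq' hL c

/-! ### Each sign carries half of the squarefree integers -/

/-- **The negative squarefree integers have `twistDensity` `1/2`** (the class `0 (mod 1)`, negative sign).
[cite: MontgomeryVaughan2007, §2.1 Thm. 2.2] -/
theorem twistDensity_neg : twistDensity (fun d => d < 0) (1 / 2) := by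
  have h := twistDensity_neg_modEq Nat.one_pos (c := 0) (by simp)
  simp only [Nat.cast_one, mul_one, Nat.primeFactors_one, prod_empty] at h
  exact (twistDensity_congr (fun d _ => by simp [Int.modEq_one]) _).1 h

/-- **The positive squarefree integers have `twistDensity` `1/2`** (the class `0 (mod 1)`, positive sign).
[cite: MontgomeryVaughan2007, §2.1 Thm. 2.2] -/
theorem twistDensity_pos : twistDensity (fun d => 0 < d) (1 / 2) := by
  have h := twistDensity_pos_modEq Nat.one_pos (c := 0) (by simp)
  simp only [Nat.cast_one, mul_one, Nat.primeFactors_one, prod_empty] at h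
  exact (twistDensity_congr (fun d _ => by simp [Int.modEq_one]) _).1 h

end Literature.NumberTheory.EllipticCurves

end
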